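import Literature.NumberTheory.Automorphic.Liu2021.LemD1DataOfPlace
import HarnessLib

/-!
# [Liu2021, App. D §D.1 / Lemma D.1] at a finite place: the FAMILY over all triples `(μ_v, ε_v, χ_v)`

Sequel of `Liu2021/LemD1DataOfPlace.lean` (the single-triple junction `LemD1OfPlace.data` between the as-printed datum
`LemD1Data` of `Liu2021/LemD1AsPrinted.lean` and the tree's local model at a finite place `v` of a quadratic extension
`E/F` of number fields: `F_v`, `E_v = Π_{w∣v} E_w`, `c ⊗ 1`, `U(J)(F_v) = UnitaryGroup.localPi E c N J v`, the local centre,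
`TwistedCoinv.rep χ ω`).  Items (2)–(4) of [Liu2021, App. D, Lemma D.1] — in particular (3), «If `n ≥ 3`, then
`ω(μ', ε', χ')` is isomorphic to `ω(μ, ε, χ)` if and only if `(μ', ε', χ') = (μ, ε, χ)`» (`FJcycle.tex` l. 5233), the local
input of Thm. 4.18 (2) — compare `ω(μ, ε, χ)` for DIFFERENT triples and are typed over the family datum
`LemD1Family F E n` (`LemD1AsPrinted.lean` §2; consumed by `Liu2021/LemD1LocalInjectivity.lean`).  This file is the
FAMILY-VALUED TWIN of `LemD1OfPlace.data`:

* §1 packaging of the caller's real data as elements of the as-printed index sets of the standing data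
  `S = LemD1OfPlace.standingData` at `v`: `muOf` (a Step-2 character `μ : E_vˣ → ℂ^1` with its three printed properties ↦
  `LemD1.MuSet S`), `epsOf`∕`epsDelta` (a unit of `E_v` in `E_v⁻`, e.g. `δ ⊗ 1` ↦ `LemD1.EpsRep S`), `chiOf` (a unitary
  continuous character `χ` of the tree's local centre `U(J₁)(F_v)` ↦ `χ ∘ θ ∈ LemD1.ChiSet S`, `θ = LemD1OfPlace.theta`);
* §2 **`LemD1OfPlace.family ω`** — the `LemD1Family F_v E_v N` at `v` whose ⟨CARRIER⟩ family `ω(μ, ε)` is a given family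
  `ω μ e : Representation ℂ (localPi E c N J v) (V μ e)` over ALL `μ ∈ MuSet S` and ALL representatives `e ∈ EpsRep S`, read
  on `U(V)(F_v) = S.U` along `uEquiv` (exactly as `data` reads one `ω`); unfolding lemmas; and the IDENTITY OF RECORDS
  `lemD1_1AsPrinted_single_iff`: Lemma D.1 (1) as printed for the family's single datum at `(muOf μ, e, chiOf χ)` IS Lemma D.1 (1)
  as printed for `LemD1OfPlace.data … (ω (muOf μ) e) μ … χ …` (the two `LemD1Data` differ only in the Step-1 field `eps`,
  which the printed sentence does not mention — `Iff.rfl`);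
* §3 the family forms of the junction theorems of `LemD1DataOfPlace` §6: from `(family ω).Item1AsPrinted` (Lemma D.1 (1)
  at every triple) — irreducibility ∕ admissibility ∕ non-vanishing of every `TwistedCoinv.rep χ (ω μ e)` (`N ≥ 3`); and the
  EQUIVARIANT IDENTIFICATION `quotEquivRep` of the family's `ω(μ, ε, χ)` (`(family ω).quot`, on `S.U`) with the tree's
  `TwistedCoinv.rep χ (ω μ e)` read along `uEquiv` (identity on representatives).  With `Lf v := family (ω_v)` at every
  finite place, the theorems of `Liu2021/LemD1LocalInjectivity.lean` apply verbatim: `LemD1Family.localParam_eq_of_nonempty_equiv`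
  (the local injectivity `hD` from `LemD1_3AsPrinted (family ω_v)`), `LemD1Family.Item1AsPrinted.isIrreducible_quot_localParam`,
  and the Δ2 bridge's `hsepW` supplier `Liu2021.hsep_of_lemD1AsPrinted` — whose LOCAL ISOTYPY input is then stated on the
  caller's carriers through `quotEquivRep`.

Nothing is asserted about the Weil representation: the carrier family `ω` is a PARAMETER (the Ω-owner of the Δ2 bridge
instantiates it with the local Weil representations of the pairs `(V, ⟨a_ε⟩)` pulled back along the splittings `ι_μ`),
and Lemma D.1 enters only as the hypotheses `Item1AsPrinted` ∕ `LemD1_3AsPrinted` (`Prop`s).  DEFINITIONS `muOf`, `epsOf`,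
`epsDelta`, `chiOf`, `family`, `quotEquivRep` (packaging ∕ transport only) + theorems; no named fact, no `sorry`.  (This file does
not import `LemD1LocalInjectivity`, so that it elaborates independently of it.)  Cell pub-hodgecm2 (COR-CM), Δ2 BRIDGE
cite legs (assembler DECISION #6 (3)(i), HOME/INBOX l. 10835); seat prover-pub-hodgecm2-b10-g67-0.  HC_CM is NOT proved;
«Δ2 BRIDGE CLOSED» is NOT claimed.

## References
* [Liu2021] Y. Liu, *Fourier–Jacobi cycles and arithmetic relative trace formula*, Camb. J. Math. 9 (2021),
  arXiv:2102.11518 — App. D §D.1 Steps 1–3 (l. 5213–5224), Lemma D.1 (l. 5226–5237), Thm. 4.18 (2) (l. 2241, 2270).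
* [Mok2014] C. P. Mok, Mem. AMS 235 (2015), §1 Notation p. 5 — `U(J)(F_v)`, through `LemD1DataOfPlace`.
-/

noncomputable section

open scoped TensorProduct Matrix MatrixGroups
open NumberField IsDedekindDomain
open Literature.RepresentationTheory
open Literature.RepresentationTheory.Liu2021 (OscillatorStandingData)
open Literature.RepresentationTheory.CentralCharacterQuotient (augmentation quotRep)

namespace Literature.NumberTheory.Automorphic.Liu2021.LemD1OfPlace

open UnitaryGroup

variable {F : Type} (E : Type) [Field F] [NumberField F] [Field E] [NumberField E] [Algebra F E]
  [Algebra.IsQuadraticExtension F E] (v : HeightOneSpectrum (𝓞 F))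
  (c : E ≃ₐ[F] E) (N : ℕ) (J : Matrix (Fin N) (Fin N) E)
  {δ : E} (hcδ : c δ = -δ) (hδ : δ ≠ 0) (hN : 2 ≤ N) (hJh : (J.map c)ᵀ = J) (hJdet : J.det ≠ 0)
  (J₁ : Matrix (Fin 1) (Fin 1) E)

/-! ## §1 The caller's data as elements of the as-printed index sets `MuSet S`, `EpsRep S`, `ChiSet S` at `v` -/

/-- **Step 2 at `v`, packaged**: a character `μ : E_vˣ → ℂˣ` with the three printed properties (values in `ℂ^1`,
continuous, `μ|_{F_vˣ}` of kernel exactly `Nm E_vˣ`) as an element of `LemD1.MuSet (standingData …)`.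
[cite: Liu2021, App. D §D.1 Step 2 (l. 5219)] -/
def muOf (μ : (LocalRing E v)ˣ →* ℂˣ) (hμn : ∀ x, ‖((μ x : ℂˣ) : ℂ)‖ = 1) (hμc : Continuous fun x => ((μ x : ℂˣ) : ℂ))
    (hμF : ∀ a : (v.adicCompletion F)ˣ,
      μ (Units.map (algebraMap (v.adicCompletion F) (LocalRing E v)).toMonoidHom a) = 1 ↔
        ∃ x : (LocalRing E v)ˣ, (x : LocalRing E v) * conjLocal E c v x =
          algebraMap (v.adicCompletion F) (LocalRing E v) a) :
    LemD1.MuSet (standingData E v c N J hcδ hδ hN hJh hJdet) :=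
  ⟨μ, hμn, hμc, hμF⟩

/-- **Step 1 at `v`, packaged**: a unit `e` of `E_v` lying in `E_v⁻ = S.skew` as a representative in `LemD1.EpsRep (standingData …)`.
[cite: Liu2021, App. D §D.1 Step 1 (l. 5217)] -/
def epsOf (e : (LocalRing E v)ˣ) (he : (e : LocalRing E v) ∈ (standingData E v c N J hcδ hδ hN hJh hJdet).skew) :
    LemD1.EpsRep (standingData E v c N J hcδ hδ hN hJh hJdet) :=
  ⟨e, he⟩

/-- the representative `δ ⊗ 1` of `LemD1OfPlace.data` (`eps`, `eps_mem_skew`) as an element of `LemD1.EpsRep (standingData …)`.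
[cite: Liu2021, App. D §D.1 Step 1 (l. 5217)] -/
def epsDelta : LemD1.EpsRep (standingData E v c N J hcδ hδ hN hJh hJdet) :=
  ⟨eps E v hδ, eps_mem_skew E v c N J hcδ hδ hN hJh hJdet⟩

/-- **Step 3 at `v`, packaged**: a unitary continuous character `χ` of the tree's local centre `U(J₁)(F_v) = localPi E c 1 J₁ v`
gives the character `χ ∘ θ` of `E_v¹ = S.normOne` in `LemD1.ChiSet (standingData …)` (`θ = LemD1OfPlace.theta`, continuous).
[cite: Liu2021, App. D §D.1 Step 3 (l. 5221)] -/
def chiOf (χ : localPi E c 1 J₁ v →* ℂˣ) (hχn : ∀ h, ‖((χ h : ℂˣ) : ℂ)‖ = 1) (hχc : Continuous fun h => ((χ h : ℂˣ) : ℂ)) :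
    LemD1.ChiSet (standingData E v c N J hcδ hδ hN hJh hJdet) :=
  ⟨χ.comp (theta E v c N J hcδ hδ hN hJh hJdet J₁), fun _ => hχn _,
    hχc.comp (continuous_theta E v c N J hcδ hδ hN hJh hJdet J₁)⟩

/-- unfolding: the character of `chiOf χ` is `χ ∘ θ`. [cite: Liu2021, App. D §D.1 Step 3 (l. 5221)] -/
@[simp] theorem chiOf_val (χ : localPi E c 1 J₁ v →* ℂˣ) (hχn : ∀ h, ‖((χ h : ℂˣ) : ℂ)‖ = 1)
    (hχc : Continuous fun h => ((χ h : ℂˣ) : ℂ)) :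
    (chiOf E v c N J hcδ hδ hN hJh hJdet J₁ χ hχn hχc).1 = χ.comp (theta E v c N J hcδ hδ hN hJh hJdet J₁) := rfl

/-! ## §2 The family datum at `v` on a given carrier family `ω μ e` of representations of `UnitaryGroup.localPi` -/

variable {V : LemD1.MuSet (standingData E v c N J hcδ hδ hN hJh hJdet) →
    LemD1.EpsRep (standingData E v c N J hcδ hδ hN hJh hJdet) → Type}
  [∀ μ e, AddCommGroup (V μ e)] [∀ μ e, Module ℂ (V μ e)]
  (ω : ∀ μ e, Representation ℂ (localPi E c N J v) (V μ e))

/-- **The FAMILY of [Liu2021, App. D §D.1 + Lemma D.1] at the place `v`** on a given family `ω μ e` of representations of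
`U(J)(F_v) = UnitaryGroup.localPi E c N J v` indexed by ALL Step-2 characters `μ ∈ MuSet S` and ALL Step-1 representatives
`e ∈ EpsRep S` of the standing data `S = standingData` at `v`: `F := F_v` («nonarchimedean», Mathlib), `E := E_v` with its
module topology, `S := standingData`, and the ⟨CARRIER⟩ family `omega μ e := ω μ e ∘ uEquiv` — each `ω μ e` read on
`U(V)(F_v) = S.U`, exactly as `LemD1OfPlace.data` reads one `ω`.  The intended instance (the caller's): `ω μ e` = the local
Weil representation `ω(ε) ∘ ι_μ` of Steps 1–2 for the class of `e`. [cite: Liu2021, App. D §D.1 (l. 5213–5224) and Lemma D.1 (l. 5226–5237)] -/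
def family : LemD1Family (v.adicCompletion F) (LocalRing E v) N where
  isNonarchimedeanLocalField := inferInstance
  isModuleTopology := isModuleTopology_localRing E v
  S := standingData E v c N J hcδ hδ hN hJh hJdet
  V := V
  omega μ e := (ω μ e).comp (uEquiv E v c N J hcδ hδ hN hJh hJdet).toMulEquiv.toMonoidHom

/-- unfolding: the standing data of `family` is `standingData`. [cite: Liu2021, App. D §D.1 (l. 5213)] -/
@[simp] theorem family_S : (family E v c N J hcδ hδ hN hJh hJdet ω).S = standingData E v c N J hcδ hδ hN hJh hJdet := rfl

/-- unfolding: `(family ω).omega μ e = ω μ e ∘ uEquiv`. [cite: Liu2021, App. D §D.1 Steps 1–2 (l. 5217–5219)] -/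
theorem family_omega_apply (μ : LemD1.MuSet (standingData E v c N J hcδ hδ hN hJh hJdet))
    (e : LemD1.EpsRep (standingData E v c N J hcδ hδ hN hJh hJdet)) (g : (standingData E v c N J hcδ hδ hN hJh hJdet).U) :
    (family E v c N J hcδ hδ hN hJh hJdet ω).omega μ e g = ω μ e (uEquiv E v c N J hcδ hδ hN hJh hJdet g) := rfl

variable (μ : (LocalRing E v)ˣ →* ℂˣ) (hμn : ∀ x, ‖((μ x : ℂˣ) : ℂ)‖ = 1) (hμc : Continuous fun x => ((μ x : ℂˣ) : ℂ))
  (hμF : ∀ a : (v.adicCompletion F)ˣ,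
    μ (Units.map (algebraMap (v.adicCompletion F) (LocalRing E v)).toMonoidHom a) = 1 ↔
      ∃ x : (LocalRing E v)ˣ, (x : LocalRing E v) * conjLocal E c v x =
        algebraMap (v.adicCompletion F) (LocalRing E v) a)
  (e : LemD1.EpsRep (standingData E v c N J hcδ hδ hN hJh hJdet))
  (χ : localPi E c 1 J₁ v →* ℂˣ) (hχn : ∀ h, ‖((χ h : ℂˣ) : ℂ)‖ = 1) (hχc : Continuous fun h => ((χ h : ℂˣ) : ℂ))

/-- **IDENTITY OF RECORDS.**  Lemma D.1, first sentence + (1), AS PRINTED for the family's single datum at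
`(muOf μ, e, chiOf χ)` is — by `Iff.rfl` — the same proposition as for `LemD1OfPlace.data … (ω (muOf μ) e) μ … χ …`: the two
`LemD1Data` share `S`, `mu`, `chi = χ ∘ θ` and `omega = ω (muOf μ) e ∘ uEquiv`, and differ only in the Step-1 representative
(`e` versus `δ ⊗ 1`), which the printed sentence does not mention. [cite: Liu2021, App. D Lemma D.1 (1) (l. 5226–5229)] -/
theorem lemD1_1AsPrinted_single_iff :
    LemD1_1AsPrinted ((family E v c N J hcδ hδ hN hJh hJdet ω).single (muOf E v c N J hcδ hδ hN hJh hJdet μ hμn hμc hμF) e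
        (chiOf E v c N J hcδ hδ hN hJh hJdet J₁ χ hχn hχc)) ↔
      LemD1_1AsPrinted (data E v c N J hcδ hδ hN hJh hJdet J₁ (ω (muOf E v c N J hcδ hδ hN hJh hJdet μ hμn hμc hμF) e)
        μ hμn hμc hμF χ hχn hχc) :=
  Iff.rfl

/-! ## §3 Family forms of the junction theorems -/

variable (hJ₁ : J₁ 0 0 ≠ 0)
  (hc : ∀ (μ' : LemD1.MuSet (standingData E v c N J hcδ hδ hN hJh hJdet))
    (e' : LemD1.EpsRep (standingData E v c N J hcδ hδ hN hJh hJdet)) (g : localPi E c N J v) (h : localPi E c 1 J₁ v),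
    Commute (ω μ' e' g) ((show Representation ℂ (localPi E c 1 J₁ v) (V μ' e') from
      (ω μ' e').comp (localCenter E c N J J₁ hJ₁ v)) h))

/-- **THE FAMILY'S `ω(μ, ε, χ)` IS THE TREE'S `TwistedCoinv.rep`** (equivariant identification, data): at
`(muOf μ, e, chiOf χ)` the family's maximal `χ ∘ θ`-quotient `(family ω).quot` — a representation of `U(V)(F_v) = S.U` — is
equivalent to the tree's `TwistedCoinv.rep χ (ω (muOf μ) e)` (the maximal `χ`-quotient along the local centre
`localCenter : U(J₁)(F_v) →* U(J)(F_v)`) read on `S.U` along `uEquiv`.  The underlying linear equivalence is the identity on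
representatives: `quotEquivOfEq` (`augmentation = TwistedCoinv.ker`, same group) ∘ `LemD1OfPlace.coinvEquiv` (change of acting
pair on `V`) ∘ `quotEquivOfEq` (acting centre along the surjection `θ`, `TwistedCoinv.ker_comp_of_surjective`).  This is the
transport a supplier of LOCAL ISOTYPY needs to pass between the currency of `Liu2021.hsep_of_lemD1AsPrinted` (isotypic of type
`(family ω).quot …`) and the tree's coinvariant currency. [cite: Liu2021, App. D §D.1 Step 3 (l. 5221)] -/
def quotEquivRep :
    ((family E v c N J hcδ hδ hN hJh hJdet ω).quot (muOf E v c N J hcδ hδ hN hJh hJdet μ hμn hμc hμF) e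
        (chiOf E v c N J hcδ hδ hN hJh hJdet J₁ χ hχn hχc)).Equiv
      ((TwistedCoinv.rep χ (ω (muOf E v c N J hcδ hδ hN hJh hJdet μ hμn hμc hμF) e)
          (hc (muOf E v c N J hcδ hδ hN hJh hJdet μ hμn hμc hμF) e)).comp
        (uEquiv E v c N J hcδ hδ hN hJh hJdet).toMulEquiv.toMonoidHom) :=
  Representation.Equiv.mk
    ((Submodule.quotEquivOfEq _ _ (TwistedCoinv.augmentation_eq_ker
        ((family E v c N J hcδ hδ hN hJh hJdet ω).omega (muOf E v c N J hcδ hδ hN hJh hJdet μ hμn hμc hμF) e)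
        (standingData E v c N J hcδ hδ hN hJh hJdet).scalar
        (χ.comp (theta E v c N J hcδ hδ hN hJh hJdet J₁)))).trans
      ((coinvEquiv E v c N J hcδ hδ hN hJh hJdet J₁ (ω (muOf E v c N J hcδ hδ hN hJh hJdet μ hμn hμc hμF) e)
          μ hμn hμc hμF χ hχn hχc hJ₁).trans
        (Submodule.quotEquivOfEq _ _ (TwistedCoinv.ker_comp_of_surjective
          (show Representation ℂ (localPi E c 1 J₁ v) (V (muOf E v c N J hcδ hδ hN hJh hJdet μ hμn hμc hμF) e) from
            (ω (muOf E v c N J hcδ hδ hN hJh hJdet μ hμn hμc hμF) e).comp (localCenter E c N J J₁ hJ₁ v))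
          χ (theta E v c N J hcδ hδ hN hJh hJdet J₁) (theta_surjective E v c N J hcδ hδ hN hJh hJdet J₁ hJ₁)))))
    (fun _ => LinearMap.ext fun x => Submodule.Quotient.induction_on _ x fun _ => rfl)

include hχn hχc in
/-- **JUNCTION, irreducibility (family form)**: [Liu2021, App. D, Lemma D.1 (1)] AS PRINTED at every triple of the family
(`Item1AsPrinted`) gives, for `N ≥ 3`, the irreducibility of the maximal `χ`-quotient `TwistedCoinv.rep χ (ω (muOf μ) e)` along
the local centre — `LemD1OfPlace.isIrreducible_rep_of_lemD1_1AsPrinted` through `lemD1_1AsPrinted_single_iff`.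
[cite: Liu2021, App. D Lemma D.1 (1) (l. 5226–5229)] -/
theorem isIrreducible_rep_of_item1AsPrinted (h1 : (family E v c N J hcδ hδ hN hJh hJdet ω).Item1AsPrinted) (h3 : 3 ≤ N) :
    (TwistedCoinv.rep χ (ω (muOf E v c N J hcδ hδ hN hJh hJdet μ hμn hμc hμF) e)
      (hc (muOf E v c N J hcδ hδ hN hJh hJdet μ hμn hμc hμF) e)).IsIrreducible :=
  isIrreducible_rep_of_lemD1_1AsPrinted E v c N J hcδ hδ hN hJh hJdet J₁ _ μ hμn hμc hμF χ hχn hχc hJ₁ (hc _ e)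
    ((lemD1_1AsPrinted_single_iff E v c N J hcδ hδ hN hJh hJdet J₁ ω μ hμn hμc hμF e χ hχn hχc).1 (h1 _ e _)) h3

include hχn hχc in
/-- **JUNCTION, admissibility (family form).** [cite: Liu2021, App. D Lemma D.1 (1) (l. 5226–5229)] -/
theorem isAdmissible_rep_of_item1AsPrinted (h1 : (family E v c N J hcδ hδ hN hJh hJdet ω).Item1AsPrinted) :
    (TwistedCoinv.rep χ (ω (muOf E v c N J hcδ hδ hN hJh hJdet μ hμn hμc hμF) e)
      (hc (muOf E v c N J hcδ hδ hN hJh hJdet μ hμn hμc hμF) e)).IsAdmissible :=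
  isAdmissible_rep_of_lemD1_1AsPrinted E v c N J hcδ hδ hN hJh hJdet J₁ _ μ hμn hμc hμF χ hχn hχc hJ₁ (hc _ e)
    ((lemD1_1AsPrinted_single_iff E v c N J hcδ hδ hN hJh hJdet J₁ ω μ hμn hμc hμF e χ hχn hχc).1 (h1 _ e _))

include hχn hχc in
/-- **JUNCTION, non-vanishing (family form)**, `N ≥ 3`. [cite: Liu2021, App. D Lemma D.1 (1) (l. 5229)] -/
theorem nontrivial_coinv_of_item1AsPrinted (h1 : (family E v c N J hcδ hδ hN hJh hJdet ω).Item1AsPrinted) (h3 : 3 ≤ N) :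
    Nontrivial (TwistedCoinv.Coinv
      (show Representation ℂ (localPi E c 1 J₁ v) (V (muOf E v c N J hcδ hδ hN hJh hJdet μ hμn hμc hμF) e) from
        (ω (muOf E v c N J hcδ hδ hN hJh hJdet μ hμn hμc hμF) e).comp (localCenter E c N J J₁ hJ₁ v)) χ) :=
  nontrivial_coinv_of_lemD1_1AsPrinted E v c N J hcδ hδ hN hJh hJdet J₁ _ μ hμn hμc hμF χ hχn hχc hJ₁
    ((lemD1_1AsPrinted_single_iff E v c N J hcδ hδ hN hJh hJdet J₁ ω μ hμn hμc hμF e χ hχn hχc).1 (h1 _ e _)) h3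

end Literature.NumberTheory.Automorphic.Liu2021.LemD1OfPlace

end
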